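import Mathlib

/-!
# BC5 rung for crux `FloppyCompositeCase` (node N_C.A.2.1.1.1 FloppyStiffDichotomy, decomp-a2c lens 2, gen 6): the registered stub
`stub_rung_farPairBound`, PROVED

The pointwise FAR-PAIR BOUND behind the leakage law of the floppy/stiff dichotomy.  For the tree potential V(r) = r⁻¹²/12 − r⁻⁶/6 the
second derivative of the pair energy along a relative displacement w at relative position u (r = ‖u‖) is
q(u, w) = (14 r⁻¹⁶ − 8 r⁻¹⁰)·⟪u, w⟫² + (r⁻⁸ − r⁻¹⁴)·‖w‖².  For r⁶ ≥ 7/4 the longitudinal coefficient 14 r⁻¹⁶ − 8 r⁻¹⁰ is ≤ 0, hence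
q ≤ r⁻⁸·‖w‖² — the only input about far pairs (r ≥ 3) that the leakage inequality QFull ≤ QInt(collar) + ½Σ‖v‖² uses.  A decided instance
of the F-lever's analytic half in a regime about which `Crystallization` says nothing (it is a statement about one pair term of the Hessian
of the finite-N energy, not about limits of ground states).
-/

namespace Summit.AtomisticToContinuum.Crystallization.Theorems.FloppyStiffDichotomyFloppyCompositeCaseRung

/-- For `r > 0` with `r⁶ ≥ 7/4`: `7·(r⁻¹)⁶ ≤ 4`. -/
theorem seven_mul_inv_pow_six_le (r : ℝ) (hr : 0 < r) (h : (7 : ℝ) / 4 ≤ r ^ 6) : 7 * r⁻¹ ^ 6 ≤ 4 := by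
  have hs : 0 < r⁻¹ ^ 6 := pow_pos (inv_pos.mpr hr) 6
  have h6 : r⁻¹ ^ 6 * r ^ 6 = 1 := by
    rw [← mul_pow, inv_mul_cancel₀ hr.ne', one_pow]
  nlinarith [mul_le_mul_of_nonneg_left h hs.le]

/-- The longitudinal LJ Hessian coefficient is non-positive beyond `r⁶ = 7/4`: `14 r⁻¹⁶ − 8 r⁻¹⁰ ≤ 0`. -/
theorem longCoeff_nonpos (r : ℝ) (hr : 0 < r) (h : (7 : ℝ) / 4 ≤ r ^ 6) : 14 * r⁻¹ ^ 16 - 8 * r⁻¹ ^ 10 ≤ 0 := by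
  have hs10 : 0 < r⁻¹ ^ 10 := pow_pos (inv_pos.mpr hr) 10
  have h16 : r⁻¹ ^ 16 = r⁻¹ ^ 10 * r⁻¹ ^ 6 := by ring
  have h7 := seven_mul_inv_pow_six_le r hr h
  nlinarith [mul_le_mul_of_nonneg_left h7 hs10.le]

/-- **BC5 rung** (= the registered plan stub `stub_rung_farPairBound` of the skeleton line of `FloppyCompositeCase`, by name and
signature): for `r > 0` with `r⁶ ≥ 7/4` and all `a, m ≥ 0`,
`(14 r⁻¹⁶ − 8 r⁻¹⁰)·a + (r⁻⁸ − r⁻¹⁴)·m ≤ r⁻⁸·m`. -/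
theorem stub_rung_farPairBound :
    ∀ r a m : ℝ, 0 < r → (7 : ℝ) / 4 ≤ r ^ 6 → 0 ≤ a → 0 ≤ m →
      (14 * r⁻¹ ^ 16 - 8 * r⁻¹ ^ 10) * a + (r⁻¹ ^ 8 - r⁻¹ ^ 14) * m ≤ r⁻¹ ^ 8 * m := by
  intro r a m hr h ha hm
  have h1 := longCoeff_nonpos r hr h
  have hs14 : 0 ≤ r⁻¹ ^ 14 := (pow_pos (inv_pos.mpr hr) 14).le
  nlinarith [mul_nonneg hs14 hm, mul_le_mul_of_nonneg_right h1 ha]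

/-- Vector form: for `u ≠ 0` with `‖u‖⁶ ≥ 7/4` and any `w` in Euclidean 3-space,
`(14 ‖u‖⁻¹⁶ − 8 ‖u‖⁻¹⁰)⟪u, w⟫² + (‖u‖⁻⁸ − ‖u‖⁻¹⁴)‖w‖² ≤ ‖u‖⁻⁸ ‖w‖²`. -/
theorem farPair_bound_vec (u w : EuclideanSpace ℝ (Fin 3)) (hu : u ≠ 0) (h : (7 : ℝ) / 4 ≤ ‖u‖ ^ 6) :
    (14 * ‖u‖⁻¹ ^ 16 - 8 * ‖u‖⁻¹ ^ 10) * (inner ℝ u w) ^ 2 + (‖u‖⁻¹ ^ 8 - ‖u‖⁻¹ ^ 14) * ‖w‖ ^ 2 ≤ ‖u‖⁻¹ ^ 8 * ‖w‖ ^ 2 :=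
  stub_rung_farPairBound ‖u‖ ((inner ℝ u w) ^ 2) (‖w‖ ^ 2) (norm_pos_iff.mpr hu) h (sq_nonneg _) (sq_nonneg _)

end Summit.AtomisticToContinuum.Crystallization.Theorems.FloppyStiffDichotomyFloppyCompositeCaseRung
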